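import Summits.ResolutionOfSingularities.ResolutionOfSingularities.Theorems.WallFrames4
import Summits.ResolutionOfSingularities.ResolutionOfSingularities.Theorems.NearCutCompanion3
import Summits.ResolutionOfSingularities.ResolutionOfSingularities.Theorems.NearCutWalls2
import Summits.ResolutionOfSingularities.ResolutionOfSingularities.Theorems.ProximityCutArcLaw
import Summits.ResolutionOfSingularities.ResolutionOfSingularities.Theorems.MaxContactCutBoundaryLedger
import Summits.ResolutionOfSingularities.ResolutionOfSingularities.Theorems.MaxContactCutWallCut
import Summits.ResolutionOfSingularities.ResolutionOfSingularities.Theorems.PlanarGhostDescent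
import Literature.AlgebraicGeometry.Resolution.PointBlowupIFPGiraud
import Literature.AlgebraicGeometry.Resolution.AdicNoetherian
import HarnessLib

/-!
# WallFrames (5/17) — Kollár's wall descent in a polynomial frame; sections: Lineage (cont.), Static, Rotation, Tame

Verbatim slice of the farm-checked monolith `WallFrames.lean` of cell `decomp-res`, seat `decomp-res-lens-5`, g35
(sha256 7405a21d81d102a4…, monolith lines 1090–1347); one namespace `Summit.ResolutionOfSingularities.ResolutionOfSingularities.Theorems.WallFrames` across the
slices, imports chained.  The monolith's module docstring (laws W1–W7, mechanism, novelty, honest placement) is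
reproduced in slice 1; the main theorem `balancedWallPort_holds : WallCut.BalancedWallPort` (hypothesis-free) and the
host-route corollary `ecBalancedWallPort_holds` (aside item 27368 of route MaxContactCut) are in slice 16/17.
-/

open MvPolynomial Finset
open scoped BigOperators
open Literature.AlgebraicGeometry.Resolution
open Literature.AlgebraicGeometry.Resolution.Hauser2010
open Literature.AlgebraicGeometry.Resolution.PointBlowup
open Literature.AlgebraicGeometry.Resolution.HauserPerlega2024

namespace Summit.ResolutionOfSingularities.ResolutionOfSingularities.Theorems.WallFrames

variable {σ : Type*} [Fintype σ] [DecidableEq σ] {K : Type*} [Field K]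

section Lineage

omit [Fintype σ] in
/-- **THE DIRECTRIX READING OF A NEAR CENTRE.**  For `s ≤ ord₀ G` and `b_j = 0`:
`(translate b (cT_s^j G))(0) = in_s(G)(b̂)`, `b̂ = b[j ↦ 1]`.  With `in_s G = c · ℓ^s` (lens-3 `directrix_of_plateau`)
a centre is NEAR (`G'(0) = 0`) iff `ℓ(b̂) = 0`; so the torus-fixed centres of balanced near moves are `P(Π) ∩ P(W)`, and a
free-chart centre `b = β e_v` is admissible iff `α_v β + α_z = 0` has a solution `β ≠ 0`, i.e. iff `α_v ≠ 0`. [new] -/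
theorem constantCoeff_translate_chartTransform (j : σ) {b : σ → K} (hbj : b j = 0) {s : ℕ} {G : MvPolynomial σ K}
    (hG : (s : ℕ∞) ≤ ordZero G) :
    constantCoeff (PointBlowup.translate b (chartTransform s j G)) =
      eval (Function.update b j 1) (homogeneousComponent s G) := by
  have hH : (homogeneousComponent s G).IsHomogeneous s := homogeneousComponent_isHomogeneous s G
  have hR : ((s + 1 : ℕ) : ℕ∞) ≤ ordZero (G - homogeneousComponent s G) := Hauser2010.succ_le_ordZero_sub_homogeneousComponent hG
  have hsplit : G = homogeneousComponent s G + (G - homogeneousComponent s G) := by ring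
  rw [Rescue.ToricGuard.constantCoeff_translate]
  conv_lhs => rw [hsplit]
  rw [chartTransform_add, map_add, eval_chartTransform_eq_zero_of_lt j hbj hR, add_zero,
    chartTransform_eq_dehom_of_isHomogeneous j hH, eval_dehom]

/-- **THE RECENTRING LAW.**  Lost-wall chart `j ≠ z`, torus-fixed centre `b = b_z e_z`, frame hypersurface
`h = Q · (y_z − ζ) + r` with `Q(0) ≠ 0`, `ζ` `z`-free in `𝔪`, `r ∈ 𝔪²`: if the centre lies on the strict transform of
`{h = 0}` (§5) then `b_z = coeff_{e_j} ζ`, i.e. the transported frame datum `ζ' = cT_1^j ζ − b_z` lies in `𝔪` again. [new] -/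
theorem recentring {z j : σ} (hjz : j ≠ z) {b : σ → K} (hb : ∀ i, i ≠ z → b i = 0)
    {h Q ζ r : MvPolynomial σ K} (hfac : h = Q * (X z - ζ) + r) (hQ0 : constantCoeff Q ≠ 0)
    (hζ : (∀ μ ∈ ζ.support, μ z = 0)) (hζ1 : (1 : ℕ∞) ≤ ordZero ζ) (hr : ((2 : ℕ) : ℕ∞) ≤ ordZero r)
    (hcentre : eval b (chartTransform 1 j h) = 0) :
    b z = coeff (Finsupp.single j 1) ζ ∧ (1 : ℕ∞) ≤ ordZero (chartTransform 1 j ζ - C (b z)) := by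
  classical
  have hbj : b j = 0 := hb j hjz
  have hXζ : (1 : ℕ∞) ≤ ordZero (X z - ζ) := le_ordZero_sub (by rw [ordZero_X]) hζ1
  have hQ : ((0 : ℕ) : ℕ∞) ≤ ordZero Q := by simp
  have h01 : chartTransform 1 j (Q * (X z - ζ)) = chartTransform 0 j Q * chartTransform 1 j (X z - ζ) := by
    have := NearCut.chartTransform_mul_of_le j hQ hXζ
    rwa [Nat.zero_add] at this
  have hXz : chartTransform 1 j (X z : MvPolynomial σ K) = X z := by
    rw [show (X z : MvPolynomial σ K) = monomial (Finsupp.single z 1) 1 from rfl, chartTransform_monomial]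
    have he : chartExponent 1 j (Finsupp.single z 1) = Finsupp.single z 1 := by
      ext i
      rw [chartExponent_apply]
      split_ifs with hi
      · subst hi; rw [Finsupp.degree_single, Nat.sub_self, Finsupp.single_apply, if_neg hjz.symm]
      · rfl
    rw [he]
  -- evaluate the factorisation at the centre
  have hζval : eval b (chartTransform 1 j ζ) = coeff (Finsupp.single j 1) ζ := by
    rw [eval_eq_constantCoeff_of_varFree hb (varFree_chartTransform hjz 1 hζ), constantCoeff_chartTransform_one j hζ1]
  have hQval : eval b (chartTransform 0 j Q) = constantCoeff Q := by
    rw [← Rescue.ToricGuard.constantCoeff_translate, NearCut.constantCoeff_translate_chartTransform_zero j b hbj Q]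
  have hr' : ((1 + 1 : ℕ) : ℕ∞) ≤ ordZero r := by simpa using hr
  rw [hfac, chartTransform_add, h01, chartTransform_sub, hXz, map_add, map_mul, map_sub, eval_X, hζval, hQval,
    eval_chartTransform_eq_zero_of_lt j hbj hr', add_zero] at hcentre
  have hbz : b z = coeff (Finsupp.single j 1) ζ := by
    rcases mul_eq_zero.mp hcentre with h0 | h0
    · exact absurd h0 hQ0
    · exact sub_eq_zero.mp h0
  refine ⟨hbz, ?_⟩
  rw [one_le_ordZero_iff, map_sub, constantCoeff_C, constantCoeff_chartTransform_one j hζ1, hbz, sub_self]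

end Lineage

/-! ## §7 Static frame laws: Kollár's K2 (`-i ≤ a + b`) and the K3 ideal (`all supports inside ⇒ G ∈ 𝔓^s`)

In the frame `(y_u, y_v, Z♮ = y_z − ζ)` the expansion of `G` is the monomial expansion of `σ_ζ G = zshear z ζ G`:
`G = Σ c_d · y^{d − d_z e_z} · Z♮^{d_z}`.  Row `k = d_z = s − i` carries Kollár's shifted support point
`(d_u − i, d_v − i)`.  (K2): every support monomial of `σ_ζ G` has degree `≥ s = ordZero G`, i.e. `d_u + d_v ≥ i`.
(K3 ideal): if every point of every row has `d_v ≥ i` (second coordinate inside), then `G ∈ (y_v, y_z − ζ)^s`, the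
`s`-th power of the ideal of the regular curve `{y_v = 0, y_z = ζ}` inside the kept wall. -/

section Static

omit [Fintype σ] in
/-- **(K2) law.** Support monomials of the frame expansion have degree `≥ ordZero G`. [new] -/
theorem le_degree_of_mem_support_zshear {z : σ} {ζ : MvPolynomial σ K} (hζ : (∀ μ ∈ ζ.support, μ z = 0))
    (hζ1 : (1 : ℕ∞) ≤ ordZero ζ) {s : ℕ} {G : MvPolynomial σ K} (hG : (s : ℕ∞) ≤ ordZero G) {d : σ →₀ ℕ}
    (hd : d ∈ (zshear z ζ G).support) : s ≤ d.degree := by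
  by_contra hlt
  push Not at hlt
  have hG' : (s : ℕ∞) ≤ ordZero (zshear z ζ G) := by rw [ordZero_zshear hζ hζ1]; exact hG
  exact (mem_support_iff.mp hd) ((natCast_le_ordZero_iff_forall_coeff _ s).mp hG' d hlt)

omit [Fintype σ] in
/-- A monomial whose `v`- and `z`-exponents sum to at least `s` lies in `(y_v, y_z)^s`. [folklore] -/
theorem monomial_mem_span_pair_pow {v z : σ} (hvz : v ≠ z) {s : ℕ} {d : σ →₀ ℕ} (hd : s ≤ d v + d z) (c : K) :
    (monomial d c : MvPolynomial σ K) ∈ Ideal.span {(X v : MvPolynomial σ K), X z} ^ s := by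
  classical
  set J : Ideal (MvPolynomial σ K) := Ideal.span {(X v : MvPolynomial σ K), X z} with hJ
  -- split off `y_v^{d v} y_z^{d z}`
  set d' : σ →₀ ℕ := d - Finsupp.single v (d v) - Finsupp.single z (d z) with hd'
  have hsplit : d = Finsupp.single v (d v) + Finsupp.single z (d z) + d' := by
    ext i
    simp only [hd', Finsupp.coe_add, Finsupp.coe_tsub, Pi.add_apply, Pi.sub_apply, Finsupp.single_apply]
    by_cases hiv : v = i
    · subst hiv
      simp [hvz.symm]
    · by_cases hiz : z = i
      · subst hiz
        simp [hiv]
      · simp [hiv, hiz]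
  have hmon : (monomial d c : MvPolynomial σ K) = X v ^ (d v) * X z ^ (d z) * monomial d' c := by
    rw [X_pow_eq_monomial, X_pow_eq_monomial, monomial_mul, monomial_mul, one_mul, one_mul, ← hsplit]
  have hv : (X v : MvPolynomial σ K) ∈ J := Ideal.subset_span (by simp)
  have hzJ : (X z : MvPolynomial σ K) ∈ J := Ideal.subset_span (by simp)
  have hprod : (X v ^ (d v) * X z ^ (d z) : MvPolynomial σ K) ∈ J ^ (d v + d z) := by
    rw [pow_add]
    exact Ideal.mul_mem_mul (Ideal.pow_mem_pow hv _) (Ideal.pow_mem_pow hzJ _)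
  rw [hmon]
  exact Ideal.mul_mem_right _ _ (Ideal.pow_le_pow_right hd hprod)

omit [Fintype σ] in
/-- **(K3) ideal law.**  If every monomial of the frame expansion `σ_ζ G` has `d_v + d_z ≥ s` (every shifted support
point has its `v`-coordinate inside), then `G ∈ (y_v, y_z − ζ)^s`. [new] -/
theorem mem_span_pair_pow_of_support {v z : σ} (hvz : v ≠ z) {ζ : MvPolynomial σ K} (hζ : (∀ μ ∈ ζ.support, μ z = 0)) {s : ℕ}
    {G : MvPolynomial σ K} (h : ∀ d ∈ (zshear z ζ G).support, s ≤ d v + d z) :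
    G ∈ Ideal.span {(X v : MvPolynomial σ K), X z - ζ} ^ s := by
  classical
  set P := zshear z ζ G with hP
  have hPmem : P ∈ Ideal.span {(X v : MvPolynomial σ K), X z} ^ s := by
    rw [P.as_sum]
    exact Ideal.sum_mem _ fun d hd => monomial_mem_span_pair_pow hvz (h d hd) _
  have hG : G = zshear z (-ζ) P := by rw [hP, zshear_neg_zshear hζ]
  have hmap : Ideal.map (zshear z (-ζ) : MvPolynomial σ K →+* MvPolynomial σ K)
      (Ideal.span {(X v : MvPolynomial σ K), X z} ^ s) = Ideal.span {(X v : MvPolynomial σ K), X z - ζ} ^ s := by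
    rw [Ideal.map_pow, Ideal.map_span, Set.image_pair]
    congr 2
    rw [RingHom.coe_coe, zshear_X_of_ne hvz, zshear_X_self, ← sub_eq_add_neg]
  rw [hG, ← hmap]
  exact Ideal.mem_map_of_mem _ hPmem

end Static

/-! ## §8 The rotation law of a free-chart move (W7): factor form of the new frame function

In the FREE chart `z` (centre `b`, `b_z = 0`) the lineage function `h = Q·(y_z − ζ) + r` (`Q(0) ≠ 0`, `ζ, r`
`z`-free, `ord ζ ≥ 1`, `ord r ≥ m ≥ 1`) transforms into `h'' = Q''·g'' + y_z^{m-1}·r''` with the UNIT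
`Q'' = translate b (cT_0^z Q)` (`Q''(0) = Q(0)`), the new frame germ `g'' = translate b (1 − cT_1^z ζ)` whose linear
part has `y_v`-coefficient `−coeff_{e_v} ζ` for every `v ≠ z` (so it is Newton-invertible in the new free variable as
soon as `ζ` is transversal to the lost wall), and a remainder divisible by the `(m−1)`-st power of the NEW WALL `y_z`
(wall-deep garbage).  Newton on `g''` in the new free variable then re-frames `h''` (§4), and §2/§6 resume. -/

section Rotation

omit [Fintype σ] in
/-- `cT_1^z (y_z) = 1`. [folklore] -/
theorem chartTransform_one_X_self (z : σ) : chartTransform 1 z (X z : MvPolynomial σ K) = 1 := by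
  have hX : (X z : MvPolynomial σ K) = monomial (Finsupp.single z 1) 1 := by rw [X_pow_eq_monomial.symm.trans (pow_one _)]
  have he : chartExponent 1 z (Finsupp.single z 1) = 0 := by
    ext i
    rw [chartExponent_apply]
    by_cases hi : i = z
    · subst hi; simp
    · simp [Ne.symm hi]
  rw [hX, chartTransform_monomial, he]
  rfl

omit [Fintype σ] in
/-- **ROTATION LAW (free chart, W7).** [new] -/
theorem rotation_law {z : σ} {b : σ → K} (hbz : b z = 0) {h Q ζ r : MvPolynomial σ K} (hfac : h = Q * (X z - ζ) + r)
    (hζ1 : (1 : ℕ∞) ≤ ordZero ζ) {m : ℕ} (hm : 1 ≤ m) (hr : (m : ℕ∞) ≤ ordZero r) :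
    PointBlowup.translate b (chartTransform 1 z h) =
      PointBlowup.translate b (chartTransform 0 z Q) * PointBlowup.translate b (1 - chartTransform 1 z ζ) +
        X z ^ (m - 1) * PointBlowup.translate b (chartTransform m z r) := by
  have hXζ : (1 : ℕ∞) ≤ ordZero (X z - ζ : MvPolynomial σ K) :=
    le_ordZero_sub (by rw [ordZero_X]) hζ1
  have hQ : ((0 : ℕ) : ℕ∞) ≤ ordZero Q := by simp
  have h01 : chartTransform 1 z (Q * (X z - ζ)) = chartTransform 0 z Q * chartTransform 1 z (X z - ζ) := by
    have := NearCut.chartTransform_mul_of_le z hQ hXζ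
    rwa [Nat.zero_add] at this
  have hXz : PointBlowup.translate b (X z : MvPolynomial σ K) = X z := by
    rw [NearCut.translate_eq_aeval, aeval_X, hbz, C_0, add_zero]
  rw [hfac, chartTransform_add, h01, chartTransform_sub, chartTransform_one_X_self,
    chartTransform_eq_X_pow_mul_chartTransform z hm hr]
  rw [NearCut.translate_eq_aeval] at hXz
  simp only [NearCut.translate_eq_aeval, map_add, map_mul, map_pow, hXz]

omit [Fintype σ] in
/-- **FRAME TRANSPORT (lost-wall move).**  `h = Q·(y_z − ζ) + r` with `ζ` `z`-free, `ord r ≥ m ≥ 1`; chart `j ≠ z`,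
centre `b = b_z e_z`: `translate b (cT_1^j h) = translate b (cT_0^j Q)·(y_z − ζ') + y_j^{m−1}·translate b (cT_m^j r)`
with the TRANSPORTED JET `ζ' = cT_1^j ζ − b_z` of `transport_law`: the frame factorisation is carried along (unit
`translate b (cT_0^j Q)`, `constantCoeff_rotation_unit`), the depth drops by at most one. [new] -/
theorem frame_transport {z j : σ} (hjz : j ≠ z) {b : σ → K} (hb : ∀ i, i ≠ z → b i = 0)
    {h Q ζ r : MvPolynomial σ K} (hfac : h = Q * (X z - ζ) + r)
    (hζ : (∀ μ ∈ ζ.support, μ z = 0)) (hζ1 : (1 : ℕ∞) ≤ ordZero ζ) {m : ℕ} (hm : 1 ≤ m)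
    (hr : (m : ℕ∞) ≤ ordZero r) :
    PointBlowup.translate b (chartTransform 1 j h) =
      PointBlowup.translate b (chartTransform 0 j Q) * (X z - (chartTransform 1 j ζ - C (b z))) +
        X j ^ (m - 1) * PointBlowup.translate b (chartTransform m j r) := by
  classical
  have hbj : b j = 0 := hb j hjz
  have hXζ : (1 : ℕ∞) ≤ ordZero (X z - ζ) := le_ordZero_sub (by rw [ordZero_X]) hζ1
  have hQ : ((0 : ℕ) : ℕ∞) ≤ ordZero Q := by simp
  have h01 : chartTransform 1 j (Q * (X z - ζ)) = chartTransform 0 j Q * chartTransform 1 j (X z - ζ) := by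
    have := NearCut.chartTransform_mul_of_le j hQ hXζ
    rwa [Nat.zero_add] at this
  have hXz : chartTransform 1 j (X z : MvPolynomial σ K) = X z := by
    rw [show (X z : MvPolynomial σ K) = monomial (Finsupp.single z 1) 1 from rfl, chartTransform_monomial]
    have he : chartExponent 1 j (Finsupp.single z 1) = Finsupp.single z 1 := by
      ext i
      rw [chartExponent_apply]
      split_ifs with hi
      · subst hi; rw [Finsupp.degree_single, Nat.sub_self, Finsupp.single_apply, if_neg hjz.symm]
      · rfl
    rw [he]
  have hfg : (fun i => X i + C (b i) : σ → MvPolynomial σ K) = fun i => if i = z then X z + C (b z) else X i := by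
    funext i
    split_ifs with hi
    · subst hi; rfl
    · rw [hb i hi, C_0, add_zero]
  have htr : ∀ P : MvPolynomial σ K, PointBlowup.translate b P = zshear z (C (b z)) P := by
    intro P
    rw [NearCut.translate_eq_aeval, hfg]
    rfl
  have hζfix : aeval (fun i => X i + C (b i)) (chartTransform 1 j ζ) = chartTransform 1 j ζ := by
    rw [← NearCut.translate_eq_aeval, htr, zshear_of_varFree _ (varFree_chartTransform hjz 1 hζ)]
  have hXjfix : aeval (fun i => X i + C (b i)) (X j : MvPolynomial σ K) = X j := by
    rw [aeval_X, hbj, C_0, add_zero]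
  have hXzb : aeval (fun i => X i + C (b i)) (X z : MvPolynomial σ K) = X z + C (b z) := by
    rw [aeval_X]
  rw [hfac, chartTransform_add, h01, chartTransform_sub, hXz, chartTransform_eq_X_pow_mul_chartTransform j hm hr]
  simp only [NearCut.translate_eq_aeval]
  rw [map_add, map_mul, map_mul, map_sub, map_pow, hXzb, hζfix, hXjfix]
  ring

omit [Fintype σ] in
/-- The unit of the rotation law: `Q''(0) = Q(0)`. [folklore, by name] -/
theorem constantCoeff_rotation_unit (z : σ) {b : σ → K} (hbz : b z = 0) (Q : MvPolynomial σ K) :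
    constantCoeff (PointBlowup.translate b (chartTransform 0 z Q)) = constantCoeff Q :=
  NearCut.constantCoeff_translate_chartTransform_zero z b hbz Q

omit [Fintype σ] in
/-- The new frame germ `g'' = translate b (1 − cT_1^z ζ)` has `y_v`-coefficient `−coeff_{e_v} ζ` (`v ≠ z`): the
`∂_v`-transversality of the frame to the LOST wall `v` is carried into the new free variable. [new] -/
theorem coeff_single_rotation_germ {v z : σ} (hvz : v ≠ z) {b : σ → K} (hbz : b z = 0) {ζ : MvPolynomial σ K}
    (hζ1 : (1 : ℕ∞) ≤ ordZero ζ) :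
    coeff (Finsupp.single v 1) (PointBlowup.translate b (1 - chartTransform 1 z ζ)) = -coeff (Finsupp.single v 1) ζ := by
  have hsub : PointBlowup.translate b (1 - chartTransform 1 z ζ) = 1 - PointBlowup.translate b (chartTransform 1 z ζ) := by
    simp only [NearCut.translate_eq_aeval, map_sub, map_one]
  rw [hsub, coeff_sub, coeff_single_translate_chartTransform_one hvz hbz hζ1]
  have h1 : coeff (Finsupp.single v 1) (1 : MvPolynomial σ K) = 0 := by
    rw [← C_1, coeff_C, if_neg (Finsupp.single_ne_zero.mpr one_ne_zero).symm]
  rw [h1, zero_sub]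

end Rotation

/-! ## §9 The tame initial frame (W6₀): `∂_f`-transversality of `h = D_f^{(s-1)} G`

For a companion `G` with initial form `in_s G = c · ℓ^s` (lens-3 `directrix_of_plateau`), the Hasse derivative
`h = ∂^{((s-1)e_f)} G` has linear `y_f`-coefficient `s · c · α_f^s`, `α_f = coeff_{e_f} ℓ`.  On a TAME plateau
(`p ∤ s`) with `α_f ≠ 0` (the free variable is transversal to the directrix plane — automatic on a balanced tail,
else the next centre lies on both walls) this is `≠ 0`: `h` is a smooth hypersurface germ transversal to the `y_f`-axis,
so §4 `exists_jet` applies in the variable `f` and the frame `(walls, y_f − ζ)` exists.  [Kollar2007 2.59.1, Hasse form] -/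

section Tame

omit [Fintype σ] in
/-- `coeff_{e_f} ∂^{((s-1)e_f)} G = s · coeff_{s e_f} G`. [folklore] -/
theorem coeff_single_hasseDeriv_pred (f : σ) {s : ℕ} (hs : 1 ≤ s) (G : MvPolynomial σ K) :
    coeff (Finsupp.single f 1) (hasseDeriv K (Finsupp.single f (s - 1)) G) = (s : K) * coeff (Finsupp.single f s) G := by
  obtain ⟨n, rfl⟩ : ∃ n, s = n + 1 := ⟨s - 1, by omega⟩
  rw [Nat.add_sub_cancel, coeff_hasseDeriv_single, Finsupp.single_eq_same, ← Finsupp.single_add,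
    show 1 + n = n + 1 from Nat.add_comm 1 n, Nat.choose_succ_self_right]

end Tame

end Summit.ResolutionOfSingularities.ResolutionOfSingularities.Theorems.WallFrames
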